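import Literature.MathematicalPhysics.QuantumFieldTheory.Balaban1983to89.B15Sect1Instances
import Literature.MathematicalPhysics.QuantumFieldTheory.Balaban1983to89.B15DeterminingSetsBBackgrounds

/-!
# `Balaban1983to89.B15Sect1InstancesB` — [Balaban1989LargeFieldI] (= [IV] = [B15]) §1, PRINT'S INSTANCES (1.74), (1.75), (1.77), Prop. 1, (1.79) OVER A **BOND-LEVEL SOLUTION MAP**
# `bg : B15DeterminingSetsB.DetBackgroundB P G av` AND A **BOND-DATUM FAMILY** `bd : ℕ → (ℕ → Set (Site P 0)) → BDetSet P` (read at `Z`'s maximal sequence `maxDomT M₁ Z`) —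
# `bgKZstdB ∕ chi175stdB ∕ fun177stdB ∕ IsVLambdaStdB ∕ bgU0stdB`: the print-datum parametrisation of `B15Sect1Instances` §1∕§4 (`bgKZstd ∕ chi175std ∕ fun177std ∕ IsVLambdaStd ∕
# bgU0std`); the two families `genSetDatumP` (reading (b): `bondsDet (genSet Ω k)` = `bondsDet (Bj M₁ Z k)` at `Ω := maxDomT M₁ Z`) and `lamDatumP` (print's [II] (2.3):
# `lamBondsSeq Ω k`); the site-level instances of record ARE the instance `(bg.toDetBackground, genSetDatumP)` by `rfl`

statement-level skeleton of published theorems with citation tags; proofs where landed; nothing here is a claim about the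
Yang–Mills mass gap

Cell `pub-ymgap` (HUMAN RULINGS D-0062 ∕ D-0149), lane `pub-ymgap-dag-n12-c` g34 (R134 seat (a), N12 = [B15], s1); `--kind definition --supports` K1⁹ `stmt-QuantumFields-27364`;
count-neutral.  (E1) variant (iii-b), N12 re-attachment step 2 of the lane's memo `N12-REATTACHMENT-DESIGN-2026-08-30.md` §3 (lit-balaban iface-1 g179 ∕ lead g40: NO OBJECTION to this
module as a NEW additive file; `B15Sect1Instances` UNTOUCHED).  STATEMENT-ONLY (definitions + `rfl` ∕ `Iff.rfl`); the theorems with content (the (2.12) property, (1.75) unfolded, (1.79)'s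
minimum inequality, print-vs-(b) comparison) live in the sibling THEOREMS-ONLY module `B15Sect1InstancesBBridges`.

HONESTY GUARD (director-ym №338 (5)).  PURELY ADDITIVE: print-datum parametrisation of `B15Sect1Instances` §1 and §4 (FLAG №16 ∕ LOCATE-HSEAM 5d3298b8d191f169); the (b)-instances
`bgKZstd ∕ chi175std ∕ fun177std ∕ IsVLambdaStd ∕ bgU0std` stay landed and true on their own text and remain the declarations of record on the lit-balaban SKELETON rows B15.Eq1.74 ∕
1.75 ∕ 1.77 ∕ Prop1 ∕ 1.79; NOTHING in `B15Sect1Instances` is edited; each old object at the PULLED-BACK map `bg.toDetBackground` IS the new one at `genSetDatumP` by `rfl`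
(`bgKZstd_toDetBackground`, `chi175std_toDetBackground_iff`, `fun177std_toDetBackground`, `isVLambdaStd_toDetBackground_iff`, `bgU0std_toDetBackground`), because r11's `Bj M₁ Z k` IS
`genSet (maxDomT M₁ Z) k` (`B14Eq213DetSet` :368).  No displayed premise of any consumer is deleted or weakened.  NOT parametrised here (not read by N12's Proposition-1 road; their site-level
joins `detSetNZ ∕ join214` would need bond-level twins first): §2 (1.19)–(1.21), (1.26) `detSetNZstd ∕ bgNZstd ∕ bgPPZstd ∕ vZstd` and §3 (1.22)–(1.24), (1.27), (1.53).

THE FAMILY SHAPE.  `bd : ℕ → (ℕ → Set (Site P 0)) → BDetSet P`, `(k, {Ω_j}) ↦ 𝔅`, is K0's `Node00.BondDatum F` at a FIXED torus exponent (`Node00.BondDatum F = (K : ℕ) → (ℕ → (ℕ → Set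
(Site (F.P K) 0)) → BDetSet (F.P K))`, `Node00/CriticalOnFibreTopGuardedB` :81): `Node00.genSetDatum F K = genSetDatumP` and `Node00.lamDatum F K = lamDatumP` by `rfl` at `P := F.P K`
(not stated here — this module stays `Node00`-free like its parent; the junction files state it where both are imported).  The instance is read at `Z`'s (2.13) maximal sequence
`maxDomT M₁ Z` ([III] (2.13) p.256; r11 `B14Eq213DetSet.maxDomT`), exactly as `Bj M₁ Z k := genSet (maxDomT M₁ Z) k`.

WHAT IS HERE (STATEMENT-ONLY).
* §0 `genSetDatumP`, `lamDatumP` (the two datum families at `P`-level) + `rfl` unfoldings.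
* §1 (1.74) `bgKZstdB bg M₁ bd Z k Vk := bgKZB bg (bd k (maxDomT M₁ Z)) (qsstarGIter0 k) Vk`; `bgKZstdB_apply ∕ bgKZstdB_eq_bgKZB` (`rfl`); `bgKZstd_toDetBackground` (`rfl`).
* §2 (1.75) `chi175stdB` (r12's `Chi175` with the deviation of `bgKZstdB`; the extension type `Ext175` is the parent's, datum-free); `chi175std_toDetBackground_iff` (`Iff.rfl`).
* §3 (1.77) `fun177stdB`, Prop. 1 `IsVLambdaStdB`, (1.79) `bgU0stdB`; `fun177stdB_eq ∕ fun177stdB_eq_fun177B ∕ isVLambdaStdB_iff ∕ bgU0stdB_eq` (`rfl` ∕ `Iff.rfl`); the (b)-instances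
  `fun177std_toDetBackground ∕ isVLambdaStd_toDetBackground_iff ∕ bgU0std_toDetBackground`.

HONEST SCOPE.  Definitions + `rfl` bookkeeping; nothing of Bałaban's analysis asserted or proved; no named fact inhabited; count-neutral; N12 NOT discharged; K0⁷ ∕ K1⁹ NOT closed; one
finite 𝕋⁴ programme at fixed ε — nothing continuum ∕ ℝ⁴ ∕ OS; the Yang–Mills mass gap (Clay) is NOT proved by any of this.  No `instance`, no `notation`, no `sorry`.

References: [B15] = [Balaban1989LargeFieldI] (1.74) p.192, (1.75) p.193, (1.77)–(1.78) Prop. 1 p.194, (1.79) p.195; [III] = [Balaban1988Convergent] (2.2) p.255,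
(2.10)–(2.13) pp.256–257; [II] = [Balaban1984PropagatorsII] (2.3) p.224; [I] = [Balaban1987RG1] (0.1) p.251.
-/

noncomputable section

namespace Literature.MathematicalPhysics.QuantumFieldTheory.Balaban1983to89.B15Sect1Instances

open Literature.MathematicalPhysics.QuantumFieldTheory.Balaban1983to89
open B15DeterminingSets B15DeterminingSetsB B14.Eq213DetSet B14.Eq216Concrete B15.PrelimIntegrations B15Chi124DetSets B8Eq17ClassAkV1 GaugeField
open Literature.MathematicalPhysics.QuantumFieldTheory.BalabanImbrieJaffe1984to88.BIJ85Eq453GaugeField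
open Set

variable {P : Params}

/-! ## §0  The two bond-datum families at `P`-level -/

section Families

/-- **READING (b)'s DATUM FAMILY** `(k, {Ω_j}) ↦` the bonds MEETING the members of [III] (2.2)'s `genSet Ω k` ([I] p. 251 «bonds which intersect Γ_j») — K0's `Node00.genSetDatum F K`
at a fixed torus exponent (`rfl` at `P := F.P K`); at `Ω := maxDomT M₁ Z` its value is `bondsDet (Bj M₁ Z k)` (r11 :368, `rfl`). [cite: Balaban1988Convergent, (2.2) p.255, (2.10) p.256; Balaban1987RG1, (0.1) p.251] -/
def genSetDatumP : ℕ → (ℕ → Set (Site P 0)) → BDetSet P := fun k Ω => bondsDet (genSet Ω k)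

/-- **PRINT's DATUM FAMILY** `(k, {Ω_j}) ↦` [II] (2.3)'s `Λ_j` as bond sets (`lamBondsSeq Ω k`, ruling (α) of record: inward connectors belong to no `Λ_j`) — K0's `Node00.lamDatum F K` at
a fixed torus exponent (`rfl`). [cite: Balaban1984PropagatorsII, (2.3) p.224; Balaban1988Convergent, (2.2) p.255] -/
def lamDatumP : ℕ → (ℕ → Set (Site P 0)) → BDetSet P := fun k Ω => lamBondsSeq Ω k

/-- Unfolding of `genSetDatumP`. [cite: Balaban1988Convergent, (2.2) p.255 (bookkeeping)] -/
theorem genSetDatumP_apply (k : ℕ) (Ω : ℕ → Set (Site P 0)) : (genSetDatumP k Ω : BDetSet P) = bondsDet (genSet Ω k) := rfl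

/-- Unfolding of `lamDatumP`. [cite: Balaban1984PropagatorsII, (2.3) p.224 (bookkeeping)] -/
theorem lamDatumP_apply (k : ℕ) (Ω : ℕ → Set (Site P 0)) : (lamDatumP k Ω : BDetSet P) = lamBondsSeq Ω k := rfl

/-- At `Z`'s maximal sequence reading (b)'s family IS `bondsDet (Bj M₁ Z k)` — r11's `Bj M₁ Z k := genSet (maxDomT M₁ Z) k`. [cite: Balaban1988Convergent, (2.13) p.256, (2.2) p.255 (bookkeeping)] -/
theorem genSetDatumP_maxDomT (M₁ : ℕ) (Z : Set (Site P 0)) (k : ℕ) : (genSetDatumP k (maxDomT M₁ Z) : BDetSet P) = bondsDet (Bj M₁ Z k) := rfl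

end Families

variable {G : Type*} [GaugeGroup G] {av : ∀ j, Averaging P j G} (bg : DetBackgroundB P G av) (M₁ : ℕ) (bd : ℕ → (ℕ → Set (Site P 0)) → BDetSet P)

/-! ## §1  (1.74) over `(bg, bd)`: `U_{k,Z}(V_k) = U(bd k {Ω_j(Z)}, M˙(Q_k^{s*}V_k))` -/

section Eq174B

/-- **[B15] (1.74) AT PRINT's PULL-BACK, OVER A BOND-LEVEL SOLUTION MAP AND A BOND-DATUM FAMILY**: `U_{k,Z}(V_k) = U(𝔅_k(Z), M˙(Q_k^{s*}V_k))` with `𝔅_k(Z) := bd k (maxDomT M₁ Z)` and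
`Q_k^{s*} := qsstarGIter0 k` — `B15Sect1Instances.bgKZstd` with `(bg, Bj M₁ Z k)` replaced by `(bg : DetBackgroundB, bd k (maxDomT M₁ Z))`.  Verbatim p. 192: *"Take the function
U_{k,Z}(V_k) given by U_{k,Z} = U_{k,Z}(V_k) = U(𝔹_k(Z), M˙(Q_k^{s*}V_k)). (1.74)"*.  Print-datum parametrisation of `bgKZstd` (FLAG №16 ∕ LOCATE-HSEAM 5d3298b8d191f169); the
(b)-instance stays landed and true on its own text (`bgKZstd_toDetBackground`). [cite: Balaban1989LargeFieldI, (1.74) p.192; Balaban1988Convergent, (2.12)–(2.13) pp.256–257; Balaban1984PropagatorsII, (2.3) p.224] -/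
def bgKZstdB (Z : Set (Site P 0)) (k : ℕ) (Vk : GaugeField P k G) : GaugeField P 0 G :=
  bgKZB bg (bd k (maxDomT M₁ Z)) (qsstarGIter0 k) Vk

/-- Unfolding of (1.74) over `(bg, bd)`. [cite: Balaban1989LargeFieldI, (1.74) p.192 (bookkeeping)] -/
theorem bgKZstdB_apply (Z : Set (Site P 0)) (k : ℕ) (Vk : GaugeField P k G) :
    bgKZstdB bg M₁ bd Z k Vk = bg.U (bd k (maxDomT M₁ Z)) (avgFamily av (qsstarGIter0 k Vk)) := rfl

/-- (1.74) over `(bg, bd)` is `bgKZB` at `(bd k (maxDomT M₁ Z), qsstarGIter0 k)` (definitional). [cite: Balaban1989LargeFieldI, (1.74) p.192 (bookkeeping)] -/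
theorem bgKZstdB_eq_bgKZB (Z : Set (Site P 0)) (k : ℕ) : bgKZstdB bg M₁ bd Z k = bgKZB bg (bd k (maxDomT M₁ Z)) (qsstarGIter0 k) := rfl

/-- **THE INSTANCE OF RECORD**: `bgKZstd` at the pulled-back site-level map IS `bgKZstdB` at reading (b)'s family — `rfl`. [cite: Balaban1989LargeFieldI, (1.74) p.192; Balaban1987RG1, (0.1) p.251] -/
theorem bgKZstd_toDetBackground (Z : Set (Site P 0)) (k : ℕ) : bgKZstd bg.toDetBackground M₁ Z k = bgKZstdB bg M₁ genSetDatumP Z k := rfl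

end Eq174B

/-! ## §2  (1.75) over `(bg, bd)` -/

section Chi175B

variable (Z Λ : Set (Site P 0)) (k : ℕ)

/-- **[B15] (1.75) OVER `(bg, bd)`**: *"χ_{k,Λ} = χ({inf_{V_k↾_Λ} sup_{p∈Ω^c_k} |U_{k,Z}(∂p) − 1| < 2ε_kη²})"* — `B15Sect1Instances.chi175std` with the deviation read through
`bgKZstdB` (the extension type `Ext175 Λ k V_k` is the parent's, datum-free).  The (b)-instance stays landed (`chi175std_toDetBackground_iff`). [cite: Balaban1989LargeFieldI, (1.75) p.193; Balaban1984PropagatorsII, (2.3) p.224] -/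
def chi175stdB (Ω : ℕ → Set (Site P 0)) (εk η : ℝ) (Vk : GaugeField P k G) : Prop :=
  Chi175 (fun (W : Ext175 Λ k Vk) (p : Plaq P 0) => dist1 (plaqHol (bgKZstdB bg M₁ bd Z k W.1) p)) (plaqsOf (Ω k)ᶜ) εk η

/-- The instance of record: `chi175std` at the pulled-back map IS `chi175stdB` at reading (b)'s family — `Iff.rfl`. [cite: Balaban1989LargeFieldI, (1.75) p.193; Balaban1987RG1, (0.1) p.251] -/
theorem chi175std_toDetBackground_iff (Ω : ℕ → Set (Site P 0)) (εk η : ℝ) (Vk : GaugeField P k G) :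
    chi175std bg.toDetBackground M₁ Z Λ k Ω εk η Vk ↔ chi175stdB bg M₁ genSetDatumP Z Λ k Ω εk η Vk := Iff.rfl

end Chi175B

/-! ## §3  (1.77), Prop. 1, (1.79) over `(bg, bd)` -/

section LambdaB

variable (Z Λ : Set (Site P 0)) (k : ℕ)

/-- **[B15] (1.77) OVER `(bg, bd)`**: *"Consider the function V_k↾_Λ → A(U_{k,Z}(V_k)). (1.77)"* — `fun177B` at `(bd k (maxDomT M₁ Z), qsstarGIter0 k)`; the (b)-instance `fun177std`
stays landed (`fun177std_toDetBackground`). [cite: Balaban1989LargeFieldI, (1.77) p.194; Balaban1984PropagatorsII, (2.3) p.224] -/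
def fun177stdB (Vk : GaugeField P k G) : ℝ := fun177B bg (bd k (maxDomT M₁ Z)) (qsstarGIter0 k) Vk

/-- (1.77) over `(bg, bd)` unfolded: `A(U_{k,Z}(V_k)) = wilsonAction4 (bgKZstdB … V_k)`. [cite: Balaban1989LargeFieldI, (1.77) p.194 (bookkeeping)] -/
theorem fun177stdB_eq (Vk : GaugeField P k G) : fun177stdB bg M₁ bd Z k Vk = wilsonAction4 (bgKZstdB bg M₁ bd Z k Vk) := rfl

/-- (1.77) over `(bg, bd)` is `fun177B` at the instance pair (definitional). [cite: Balaban1989LargeFieldI, (1.77) p.194 (bookkeeping)] -/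
theorem fun177stdB_eq_fun177B : fun177stdB bg M₁ bd Z k = fun177B bg (bd k (maxDomT M₁ Z)) (qsstarGIter0 k) := rfl

/-- **PROPOSITION 1's MINIMISER OVER `(bg, bd)`**: `V_Λ = V_Λ(V_k↾_{Z∩Λᶜ})` minimises (1.77) over the variables on the bonds meeting `Λ^{(k)}` — `IsVLambdaB` at the instance pair
(existence ∕ uniqueness = row B15.Prop1, NOT asserted); the (b)-instance `IsVLambdaStd` stays landed (`isVLambdaStd_toDetBackground_iff`). [cite: Balaban1989LargeFieldI, Prop. 1 (1.78) p.194; Balaban1984PropagatorsII, (2.3) p.224] -/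
def IsVLambdaStdB (Vout VΛ : GaugeField P k G) : Prop :=
  IsVLambdaB bg (bd k (maxDomT M₁ Z)) (qsstarGIter0 k) (bondsOf (pts k Λ)) Vout VΛ

/-- `IsVLambdaStdB` unfolded: `V_Λ = V_k` off `Λ` and `A(U_{k,Z}(V_Λ)) ≤ A(U_{k,Z}(W))` for every competitor `W = V_k` off `Λ`. [cite: Balaban1989LargeFieldI, Prop. 1 (1.78) p.194] -/
theorem isVLambdaStdB_iff (Vout VΛ : GaugeField P k G) :
    IsVLambdaStdB bg M₁ bd Z Λ k Vout VΛ ↔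
      (∀ b, b ∉ bondsOf (pts k Λ) → VΛ b = Vout b) ∧
        ∀ W : GaugeField P k G, (∀ b, b ∉ bondsOf (pts k Λ) → W b = Vout b) →
          fun177stdB bg M₁ bd Z k VΛ ≤ fun177stdB bg M₁ bd Z k W := Iff.rfl

/-- **[B15] (1.79) OVER `(bg, bd)`**: `U₀ = U_{k,Z}(V_Λ)` — `bgU0B` at the instance pair; the (b)-instance `bgU0std` stays landed (`bgU0std_toDetBackground`).
[cite: Balaban1989LargeFieldI, (1.79) p.195; Balaban1984PropagatorsII, (2.3) p.224] -/
def bgU0stdB (VΛ : GaugeField P k G) : GaugeField P 0 G := bgU0B bg (bd k (maxDomT M₁ Z)) (qsstarGIter0 k) VΛ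

/-- (1.79) over `(bg, bd)` unfolded: `U₀` is (1.74) at `V_Λ`. [cite: Balaban1989LargeFieldI, (1.79) p.195 (bookkeeping)] -/
theorem bgU0stdB_eq (VΛ : GaugeField P k G) : bgU0stdB bg M₁ bd Z k VΛ = bgKZstdB bg M₁ bd Z k VΛ := rfl

/-- The instance of record: `fun177std` at the pulled-back map IS `fun177stdB` at reading (b)'s family — `rfl`. [cite: Balaban1989LargeFieldI, (1.77) p.194; Balaban1987RG1, (0.1) p.251] -/
theorem fun177std_toDetBackground : fun177std bg.toDetBackground M₁ Z k = fun177stdB bg M₁ genSetDatumP Z k := rfl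

/-- The instance of record: `IsVLambdaStd` at the pulled-back map IS `IsVLambdaStdB` at reading (b)'s family — `Iff.rfl`. [cite: Balaban1989LargeFieldI, Prop. 1 (1.78) p.194; Balaban1987RG1, (0.1) p.251] -/
theorem isVLambdaStd_toDetBackground_iff (Vout VΛ : GaugeField P k G) :
    IsVLambdaStd bg.toDetBackground M₁ Z Λ k Vout VΛ ↔ IsVLambdaStdB bg M₁ genSetDatumP Z Λ k Vout VΛ := Iff.rfl

/-- The instance of record: `bgU0std` at the pulled-back map IS `bgU0stdB` at reading (b)'s family — `rfl`. [cite: Balaban1989LargeFieldI, (1.79) p.195; Balaban1987RG1, (0.1) p.251] -/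
theorem bgU0std_toDetBackground : bgU0std bg.toDetBackground M₁ Z k = bgU0stdB bg M₁ genSetDatumP Z k := rfl

end LambdaB

end Literature.MathematicalPhysics.QuantumFieldTheory.Balaban1983to89.B15Sect1Instances

end
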